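import Literature.Analysis.FluidPDE.FractionalNSTorus
import Literature.Analysis.FunctionSpaces.HolderNorm
import HarnessLib

/-!
# Prescribed-energy Hölder solutions of the fractional Navier–Stokes system (De Rosa 2019, Thm. 2.1)
# and the ingredients of the proof of De Rosa's non-uniqueness theorem

Analysis/FluidPDE facts file. De Rosa's non-uniqueness theorem for Leray(–Hopf) solutions of
`∂ₜv + div(v⊗v) + ∇p + (-Δ)^γ v = 0` on `𝕋³` with `γ < 1/3` (De Rosa 2019, Thm. 1.2; vendored as
the named fact `Literature.Barriers.NavierStokesRegularity.DeRosa2019_thm12` of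
`Literature/Barriers/NavierStokesRegularity/HypodissipativeLerayNonuniqueness`) is proved in the
source (§2, p. 5 of the held arXiv text) from exactly four ingredients, which this file vendors as
named facts in the solution notions of `Literature/Analysis/FluidPDE/FractionalNSTorus`:

* **Thm. 2.1** (`DeRosa2019_thm21`) — the output of the convex-integration scheme (the inductive
  Prop. 4.1, after Buckmaster–De Lellis–Székelyhidi–Vicol and Isett): for every admissible energy
  profile `e` there is a Hölder `C^β` distributional solution on `𝕋³ × [0,1]` with
  `∫|v|²(x,t) dx = e(t)` and `‖v‖_β ≤ C_β K^{4/9}`, and profiles with the same value at `t = 0`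
  give solutions with the same initial datum. This is the research-level core (a theory, not a
  lemma); it stays a named fact.
* **Cor. 7.2** (`DeRosa2019_cor72`) — `∫|(-Δ)^{γ/2} f|² ≤ C(ε) [f]²_{γ+ε}` for `f ∈ C^{γ+ε}(𝕋³)`
  (fractional dissipation is controlled by a slightly better Hölder seminorm).
* **Thm. 1.1** (`ColomboDeLellisDeRosa2018_thm11`, = Colombo–De Lellis–De Rosa 2018, Thm. 1.1 with
  the remark following it) — Leray's existence theorem for the fractional system: every
  divergence-free `L²` datum has a Leray solution for every exponent in `]0,1[`.
* **Prolongation** (`ColomboDeLellisDeRosa2018_prolongation`, Colombo–De Lellis–De Rosa 2018, §1,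
  paragraph after Thm. 1.3; De Rosa 2019, end of the proof of Thm. 1.2) — a `C^β` solution on
  `[0,T]` obeying the energy inequality for all `0 ≤ s ≤ t ≤ T` prolongs (by Thm. 1.1 applied at
  time `T`, the system being invariant under time shifts) to a Leray solution on `[0,∞)`.

The assembly "Thm. 2.1 + Cor. 7.2 + prolongation ⇒ Thm. 1.2" (the printed proof of Thm. 1.2:
an infinite family of admissible profiles with common value at `0` and steep initial decrease,
strict energy dissipation on `[0,T]` for `K` large, prolongation) is carried out in
`Literature/Barriers/NavierStokesRegularity/HypodissipativeLerayNonuniquenessProofs`.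

## Normalisation (read this before comparing with the printed constants)

The tree's torus is Mathlib's unit torus `UnitAddTorus (Fin 3) = (ℝ/ℤ)³` with probability Haar
measure and dissipation symbol `(2π|k|)^{2γ}` (`Torus.fracLaplacian`, `Torus.eFracDissipation`),
whereas the sources print `e^{ik·x}`-Fourier series with symbol `|k|^{2γ}` and Lebesgue measure.
A printed solution `v` corresponds to a tree solution `v'(x',t') = λ v(a x', μ t')` for explicit
positive constants `λ, a, μ` depending only on `γ` (see the design notes of `FractionalNSTorus`);
under this dictionary energies are multiplied by a constant, times by `μ⁻¹`, and Hölder norms by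
at most `λ max(1, a^β)`. Statements without fixed numerical constants (Thm. 1.1, Thm. 1.2,
Cor. 7.2 with its unspecified `C(ε)`, the prolongation remark) transfer verbatim. Thm. 2.1 fixes
the window `½ ≤ e ≤ 1` on `[0,1]` and the slope bound `sup|e'| ≤ K`; its image under the
dictionary is the same statement for the window `c₀/2 ≤ e ≤ c₀` on `[0,T₀]` with slope bound
`c₀K/T₀`, for some positive constants `c₀, T₀` depending only on `γ`. `DeRosa2019_thm21`
therefore quantifies `∃ c₀ T₀ > 0` (and absorbs `λ max(1,a^β)` into the existential constant
`C`); with `c₀ = T₀ = 1` it is literally the printed normalisation. This is weaker than any fixed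
normalisation and is exactly what the proof of Thm. 1.2 consumes.

## What is (not) transcribed

* Thm. 2.1 is stated for *smooth* profiles `e : ℝ → ℝ` (constraints only on `[0,T₀]`); the
  source allows `e : [0,1] → ℝ⁺` with `sup|e'| ≤ K` (so at least `C¹`); restricting the
  hypothesis class weakens the fact, and the proof of Thm. 1.2 only uses smooth profiles
  ("an infinite set `𝓔_K` of smooth functions", §2).
* "`(v,p)` solves (NS_γ) in the sense of distributions" on `𝕋³ × (0,1)` is transcribed by the
  tree's pressure-free distributional notion `Torus.IsWeakFracNSSolutionOn T₀ γ 1 v`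
  (divergence-free test fields compactly supported in `(0,T₀)`; for the continuous fields at
  hand this is implied by the printed notion: test the momentum equation with divergence-free
  fields, the pressure drops out). "`v ∈ C^β(𝕋³ × [0,1])`" is the tree's space–time Hölder class
  `Literature.HolderOnSpaceTime β T₀ v`; the bound "`‖v‖_β ≤ C_β K^{4/9}`" (`‖·‖_β = ‖·‖₀ + [·]_β`,
  spatial Hölder norms with the supremum over `t`, §3 of the source) is transcribed slice-wise
  through `Literature.eBoundedHolderNorm β (v t) = ‖v t‖_∞ + [v t]_β`, which the printed bound implies.
  The printed range "for all `β < γ < 1/3`" in Thm. 2.1 is a misprint for `γ < β < 1/3` (the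
  dissipation exponent is `γ`; Thm. 1.2 and the proof, "choosing `ε` so that `γ + ε = β`", use
  `γ < β < 1/3`); we transcribe `γ < β < 1/3`.
* "the two corresponding solutions start from the same initial data" refers to the solution
  *assigned to* a profile by the construction; it is transcribed by an existentially quantified
  solution map `v : (ℝ → ℝ) → (ℝ → 𝕋³ → ℝ³)` on admissible profiles.
* Cor. 7.2's constant is printed as `C(ε)`; here it may depend on `γ` and `ε` (weaker).
* Thm. 1.1 is vendored in the form both papers *use* ("there exists a Leray(–Hopf) solution"):
  Colombo–De Lellis–De Rosa print the energy inequality (2) from time `0` in Thm. 1.1 and add, in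
  the remark following it, that Leray's solutions also satisfy (3) from a.e. `s ≥ 0` — together,
  a Leray solution in their sense, `Torus.IsLerayFracSolution` (whose `L²_t H^α_x` clause is read
  locally in time, see `FractionalNSTorus`). De Rosa's restatement (his Thm. 1.1) asks (2) for
  *all* `0 ≤ s < t`, which is more than Colombo–De Lellis–De Rosa prove; we vendor the weaker,
  proved form.
* The prolongation remark is vendored with the hypotheses it is applied to in both papers
  (conclusions (b)–(c) of CDLDR Thm. 1.3 / De Rosa Thm. 1.2 (a)–(b)): a space–time `C^β`
  solution on `[0,T]`, `0 < α < β < 1/3`, obeying the energy inequality for all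
  `0 ≤ s < t ≤ T`.

## References

* L. De Rosa, *Infinitely many Leray–Hopf solutions for the fractional Navier–Stokes equations*,
  Comm. PDE 44 (2019), 335–365 (held: arXiv:1801.10235): §1 Thms. 1.1–1.2; §2 Thm. 2.1 and the
  proof of Thm. 1.2 (p. 5); §3 (Hölder norms); §7 Thm. 7.1, Cor. 7.2 (p. 19). [`Derosa2018`]
* M. Colombo, C. De Lellis, L. De Rosa, *Ill-posedness of Leray solutions for the hypodissipative
  Navier–Stokes equations*, Comm. Math. Phys. 362 (2018), 659–688 (held: arXiv:1708.05666): §1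
  Thm. 1.1, ineq. (2)–(3), Thms. 1.2–1.3 and the paragraph after Thm. 1.3 (p. 3); §9 (proof of
  Thm. 1.1, p. 20). [`ColomboDelellisDerosa2018`]
* T. Buckmaster, C. De Lellis, L. Székelyhidi Jr., V. Vicol, *Onsager's conjecture for admissible
  weak solutions*, CPAM 72 (2019) (the scheme adapted in Thm. 2.1). [`BuckmasterEtAl2018`]
* L. Roncal, P. R. Stinga, *Fractional Laplacian on the torus*, Commun. Contemp. Math. 18 (2016),
  Thm. 1.4 (source of Thm. 7.1, case `β = 0`). [`RoncalStinga2016`]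
-/

noncomputable section

open MeasureTheory Set Filter Topology
open scoped ENNReal NNReal ContDiff

namespace Literature.Analysis.FluidPDE

section NS

local notation "𝕋³" => UnitAddTorus (Fin 3)
local notation "ℝ³" => EuclideanSpace ℝ (Fin 3)

/-! ## Admissible energy profiles -/

/-- **Admissible energy profiles** (hypotheses (i)–(ii) of De Rosa 2019, Thm. 2.1, in the
normalised window of this file): a smooth `e : ℝ → ℝ` with `c₀/2 ≤ e(t) ≤ c₀` and
`|e'(t)| ≤ c₀ K / T₀` for `t ∈ [0, T₀]`. For `c₀ = T₀ = 1` these are the printed conditions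
"(i) `½ ≤ e(t) ≤ 1 ∀ t ∈ [0,1]`; (ii) `sup_t |e'(t)| ≤ K`" (smoothness: see the file header).
[cite: Derosa2018, §2 Thm. 2.1 (i)–(ii)] -/
structure IsEnergyProfile (c₀ T₀ K : ℝ) (e : ℝ → ℝ) : Prop where
  /-- The profile is smooth on `ℝ`. -/
  contDiff : ContDiff ℝ ∞ e
  /-- Lower bound `c₀/2 ≤ e` on `[0, T₀]` (printed: `½ ≤ e`). -/
  lower : ∀ t ∈ Icc 0 T₀, c₀ / 2 ≤ e t
  /-- Upper bound `e ≤ c₀` on `[0, T₀]` (printed: `e ≤ 1`). -/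
  upper : ∀ t ∈ Icc 0 T₀, e t ≤ c₀
  /-- Slope bound `|e'| ≤ c₀ K / T₀` on `[0, T₀]` (printed: `sup |e'| ≤ K`). -/
  abs_deriv_le : ∀ t ∈ Icc 0 T₀, |deriv e t| ≤ c₀ * K / T₀

/-- The constant profile `e ≡ c₀` is admissible for every `c₀ ≥ 0`, `K ≥ 0`, `T₀ ≥ 0`
(non-vacuity of `IsEnergyProfile`). [folklore] -/
theorem isEnergyProfile_const {c₀ T₀ K : ℝ} (hc₀ : 0 ≤ c₀) (hT₀ : 0 ≤ T₀) (hK : 0 ≤ K) :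
    IsEnergyProfile c₀ T₀ K (fun _ => c₀) where
  contDiff := contDiff_const
  lower := fun _ _ => by linarith
  upper := fun _ _ => le_rfl
  abs_deriv_le := fun _ _ => by
    rw [deriv_const', abs_zero]
    positivity

/-- Admissibility is monotone in the slope parameter `K`. [folklore] -/
theorem IsEnergyProfile.mono {c₀ T₀ K K' : ℝ} {e : ℝ → ℝ} (h : IsEnergyProfile c₀ T₀ K e)
    (hc₀ : 0 ≤ c₀) (hT₀ : 0 ≤ T₀) (hK : K ≤ K') : IsEnergyProfile c₀ T₀ K' e where
  contDiff := h.contDiff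
  lower := h.lower
  upper := h.upper
  abs_deriv_le := fun t ht =>
    (h.abs_deriv_le t ht).trans (div_le_div_of_nonneg_right (by nlinarith) hT₀)

/-- An admissible profile is differentiable. [folklore] -/
theorem IsEnergyProfile.differentiable {c₀ T₀ K : ℝ} {e : ℝ → ℝ} (h : IsEnergyProfile c₀ T₀ K e) :
    Differentiable ℝ e :=
  h.contDiff.differentiable (by simp)

/-! ## De Rosa 2019, Thm. 2.1: Hölder solutions with prescribed kinetic energy -/

/-- **De Rosa 2019, Thm. 2.1** (solutions of the fractional Navier–Stokes system with prescribed
kinetic energy; the output of the convex-integration scheme of §4, Prop. 4.1). As printed: "Let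
`e : [0,1] → ℝ⁺` with (i) `½ ≤ e(t) ≤ 1 ∀ t ∈ [0,1]`; (ii) `sup_t |e'(t)| ≤ K` for some `K > 1`.
Then for all `γ < β < 1/3` [printed `β < γ < 1/3`, a misprint] there exists a couple `(v, p)`
solving `∂ₜv + v·∇v + ∇p + (-Δ)^γ v = 0`, `div v = 0` in the sense of distributions, such that
`v ∈ C^β(𝕋³ × [0,1])` and `e(t) = ∫_{𝕋³} |v|²(x,t) dx`, `‖v‖_β ≤ C_β K^{4/9}`, where `C_β` is a
constant depending only on `β`. Moreover, given any two energy profiles `e₁` and `e₂` such that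
`e₁(0) = e₂(0)`, the two corresponding solutions `v⁽¹⁾` and `v⁽²⁾` start from the same initial
data, i.e. `v⁽¹⁾(·,0) ≡ v⁽²⁾(·,0)`."

Transcription (see the file header for the normalisation): for `0 < γ < β < 1/3` there are
window constants `c₀, T₀ > 0` and `C > 0` such that for every `K > 1` there is a solution map
`v` on the admissible profiles `IsEnergyProfile c₀ T₀ K` with, for each admissible `e`:
`v e` is a distributional solution on `𝕋³ × (0,T₀)` (`Torus.IsWeakFracNSSolutionOn T₀ γ 1`,
viscosity `1`), `v e ∈ C^β(𝕋³ × [0,T₀])` (`HolderOnSpaceTime`), `∫‖v e t x‖² dx = e t` for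
`t ∈ [0,T₀]`, `‖v e t‖_∞ + [v e t]_β ≤ C K^{4/9}` for `t ∈ [0,T₀]`; and admissible profiles with
`e₁ 0 = e₂ 0` have `v e₁ 0 = v e₂ 0`. Named fact, not proved here (convex integration).
[cite: Derosa2018, §2 Thm. 2.1] -/
def DeRosa2019_thm21 : Prop :=
  ∀ γ β : ℝ, 0 < γ → γ < β → β < 1 / 3 →
    ∃ c₀ T₀ C : ℝ, 0 < c₀ ∧ 0 < T₀ ∧ 0 < C ∧
      ∀ K : ℝ, 1 < K →
        ∃ v : (ℝ → ℝ) → ℝ → 𝕋³ → ℝ³,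
          (∀ e : ℝ → ℝ, IsEnergyProfile c₀ T₀ K e →
            Torus.IsWeakFracNSSolutionOn T₀ γ 1 (v e) ∧
              FunctionSpaces.HolderOnSpaceTime (Real.toNNReal β) T₀ (v e) ∧
              (∀ t ∈ Icc 0 T₀, ∫ x, ‖v e t x‖ ^ 2 = e t) ∧
              ∀ t ∈ Icc 0 T₀,
                FunctionSpaces.eBoundedHolderNorm (Real.toNNReal β) (v e t) ≤
                  ENNReal.ofReal (C * K ^ (4 / 9 : ℝ))) ∧
          ∀ e₁ e₂ : ℝ → ℝ, IsEnergyProfile c₀ T₀ K e₁ → IsEnergyProfile c₀ T₀ K e₂ →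
            e₁ 0 = e₂ 0 → v e₁ 0 = v e₂ 0

/-! ## De Rosa 2019, Cor. 7.2: fractional dissipation of Hölder fields -/

/-- **De Rosa 2019, Cor. 7.2** (of Thm. 7.1, "interaction with Hölder spaces", after
Roncal–Stinga). As printed: "Let `γ ∈ (0,1)`, `ε > 0` be such that `0 < γ + ε ≤ 1`, and let
`f : 𝕋³ → ℝ³`. There exists a constant `C = C(ε) > 0` such that
`∫_{𝕋³} |(-Δ)^{γ/2} f|²(x) dx ≤ C(ε) [f]²_{γ+ε}` for all `f ∈ C^{γ+ε}(𝕋³)`."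
Here `∫|(-Δ)^{γ/2}f|² = Torus.eFracDissipation γ f` (spectral form, unit torus) and `[f]_{γ+ε}`
is Mathlib's Hölder seminorm `eHolderNorm`; the constant may depend on `γ` and `ε` (weaker than
printed). Named fact, not proved here. [cite: Derosa2018, §7 Cor. 7.2] -/
def DeRosa2019_cor72 : Prop :=
  ∀ γ ε : ℝ, 0 < γ → γ < 1 → 0 < ε → γ + ε ≤ 1 →
    ∃ C : ℝ, 0 < C ∧ ∀ f : 𝕋³ → ℝ³, MemHolder (Real.toNNReal (γ + ε)) f →
      Torus.eFracDissipation γ f ≤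
        ENNReal.ofReal C * eHolderNorm (Real.toNNReal (γ + ε)) f ^ 2

/-- Under Cor. 7.2, Hölder fields of exponent above `γ` have finite fractional dissipation of
order `γ`. [cite: Derosa2018, §7 Cor. 7.2] -/
theorem DeRosa2019_cor72.eFracDissipation_lt_top (h : DeRosa2019_cor72) {γ ε : ℝ} (hγ : 0 < γ)
    (hγ1 : γ < 1) (hε : 0 < ε) (hγε : γ + ε ≤ 1) {f : 𝕋³ → ℝ³}
    (hf : MemHolder (Real.toNNReal (γ + ε)) f) : Torus.eFracDissipation γ f < ⊤ := by
  obtain ⟨C, -, hC⟩ := h γ ε hγ hγ1 hε hγε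
  refine (hC f hf).trans_lt (ENNReal.mul_lt_top ENNReal.ofReal_lt_top ?_)
  exact ENNReal.pow_lt_top hf.eHolderNorm_lt_top

/-! ## Colombo–De Lellis–De Rosa 2018, Thm. 1.1: Leray solutions exist -/

/-- **Colombo–De Lellis–De Rosa 2018, Thm. 1.1 with the remark following it; De Rosa 2019,
Thm. 1.1** (Leray's existence theorem for the fractional system). As printed (CDLDR): "For any
`v̄ ∈ L²(𝕋³)` with `div v̄ = 0` and every `α ∈ ]0,1[` there is a weak solution
`u ∈ L^∞(ℝ⁺, L²(𝕋³)) ∩ L²(ℝ⁺, H^α(𝕋³))` of (NS) such that `v(·,0) = v̄` and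
`½∫|v|²(x,t) dx + ∫₀ᵗ∫|(-Δ)^{α/2}v|² dx ds ≤ ½∫|v̄|² dx ∀ t ≥ 0`", and "the solution produced by
the proof of Theorem 1.1 can be shown to satisfy … [the energy inequality (3)] for a.e. `s` and
`∀ t > s`"; solutions satisfying both are their *Leray solutions* (`Torus.IsLerayFracSolution`,
whose class `L²(ℝ⁺; H^α)` is read locally in time — weaker). De Rosa: "For any `v̄ ∈ L²(𝕋³)`
with `div v̄ = 0` and every `γ ∈ ]0,1[` there exists a Leray–Hopf weak solution". The datum is a
weakly divergence-free `L²` field. Named fact, not proved here (Fourier–Galerkin truncation and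
an Aubin–Lions argument, CDLDR §9). [cite: ColomboDelellisDerosa2018, §1 Thm. 1.1 and ineq. (3); §9]
[cite: Derosa2018, §1 Thm. 1.1] -/
def ColomboDeLellisDeRosa2018_thm11 : Prop :=
  ∀ α : ℝ, 0 < α → α < 1 → ∀ u₀ : 𝕋³ → ℝ³, MemLp u₀ 2 volume → FunctionSpaces.Torus.IsWeaklyDivFree u₀ →
    ∃ u : ℝ → 𝕋³ → ℝ³, Torus.IsLerayFracSolution α u₀ u

/-! ## Prolongation of local Hölder solutions to global Leray solutions -/

/-- **Prolongation of local Hölder solutions** (Colombo–De Lellis–De Rosa 2018, §1, after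
Thm. 1.3: "Each solution in Theorem 1.3 can be prolonged past the time `T` using Theorem 1.1
(note that (NS) is invariant under time-shifts and so Theorem 1.1 is valid with any initial time
`T` substituting `0`): Theorem 1.2 is thus an obvious corollary"; De Rosa 2019, end of the proof
of Thm. 1.2: "using Theorem 1.1, it is not difficult to show that all these solutions can be
prolonged to Leray–Hopf solutions for every `t ≥ 0`"). The solutions in question are those of
CDLDR Thm. 1.3 (b)–(c) / De Rosa Thm. 1.2 (a)–(b): for `0 < α < β < 1/3` and `T > 0`, a field
`v ∈ C^β(𝕋³ × [0,T])` solving the system distributionally on `𝕋³ × (0,T)` and obeying the energy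
inequality `½∫|v(t)|² + ∫ₛᵗ∫|(-Δ)^{α/2}v|² ≤ ½∫|v(s)|²` for all `0 ≤ s < t ≤ T`. Conclusion: there
is a Leray solution `u` on `[0,∞)` from the datum `v(0)` (`Torus.IsLerayFracSolution`) which
agrees with `v` on `[0,T]`. Named fact, not proved here (glue `v` on `[0,T]` with a Leray
solution from `v(T)` given by Thm. 1.1; the `L²_t H^α_x` bound on `[0,T]` is Cor. 7.2).
[cite: ColomboDelellisDerosa2018, §1, paragraph after Thm. 1.3] [cite: Derosa2018, §2, proof of Thm. 1.2] -/
def ColomboDeLellisDeRosa2018_prolongation : Prop :=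
  ∀ α β T : ℝ, 0 < α → α < β → β < 1 / 3 → 0 < T →
    ∀ v : ℝ → 𝕋³ → ℝ³, FunctionSpaces.HolderOnSpaceTime (Real.toNNReal β) T v →
      Torus.IsWeakFracNSSolutionOn T α 1 v →
      (∀ s t : ℝ, 0 ≤ s → s < t → t ≤ T → Torus.FracEnergyIneq α v s t) →
      ∃ u : ℝ → 𝕋³ → ℝ³, Torus.IsLerayFracSolution α (v 0) u ∧ ∀ t ∈ Icc 0 T, u t = v t

/-- Under the prolongation fact, the datum `v(0)` of a prolongable local solution admits a Leray
solution (the special case of Thm. 1.1 that the proof of Thm. 1.2 needs).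
[cite: ColomboDelellisDerosa2018, §1, paragraph after Thm. 1.3] -/
theorem ColomboDeLellisDeRosa2018_prolongation.exists_isLerayFracSolution
    (h : ColomboDeLellisDeRosa2018_prolongation) {α β T : ℝ} (hα : 0 < α) (hαβ : α < β)
    (hβ : β < 1 / 3) (hT : 0 < T) {v : ℝ → 𝕋³ → ℝ³}
    (hH : FunctionSpaces.HolderOnSpaceTime (Real.toNNReal β) T v) (hw : Torus.IsWeakFracNSSolutionOn T α 1 v)
    (hE : ∀ s t : ℝ, 0 ≤ s → s < t → t ≤ T → Torus.FracEnergyIneq α v s t) :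
    ∃ u : ℝ → 𝕋³ → ℝ³, Torus.IsLerayFracSolution α (v 0) u :=
  let ⟨u, hu, _⟩ := h α β T hα hαβ hβ hT v hH hw hE
  ⟨u, hu⟩

end NS

end Literature.Analysis.FluidPDE
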